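import Summits.QuantumFields.YangMills.Theorems.UnitScaleTiltProp7HcoSEndToEnd
import Summits.QuantumFields.YangMills.Theorems.UnitScaleTiltProp7HN06Holds
import Summits.QuantumFields.YangMills.Theorems.UnitScaleTiltProp7HcoSOfNormG0DiffRow
import Summits.QuantumFields.YangMills.Theorems.UnitScaleTiltProp7HDOfCombRowsT3
import Summits.QuantumFields.YangMills.Theorems.UnitScaleTiltProp7CombHMcombHoldsT3
import Summits.QuantumFields.YangMills.Theorems.UnitScaleTiltProp7CombHMc2HoldsT3
import Summits.QuantumFields.YangMills.Theorems.UnitScaleTiltProp7N32SymRowT3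
import Summits.QuantumFields.YangMills.Theorems.UnitScaleTiltProp7CmapTwSupRow
import Summits.QuantumFields.YangMills.Theorems.FluctuationComparisonRegPrIntLS2BetaSigmaGrowthDoor
import HarnessLib

/-!
# S2β · organ GAP♯∘ ∕ POS∘ — (142) WITH ITS RATE, FILE 2∕2: **[Balaban1985Variational] (142) WITH ITS K-UNIFORM RATE ON THE LANDAU Σ-SLICE — the E2E knit and the
# ZERO-HYPOTHESIS theorem `sigmaGrowth_holds`**: `c(L,B₁′)·L^{−2(K−n)}·Σ_b‖X b‖² ≤ A(W·e^{iX}) − A(W)` at every E–L-critical printed-regular `W`, every Σ-competitor `X` in print's (19)(20)(21) window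
Cell `ym3-torus` (rung R3 = SU(2) YM₃ on T³ — NOT d = 4, NOT infinite volume, NOT a mass gap, NOT Clay).  Width seat `ym3-torus-px17` (gen 15), FREE px helper of `stmt-QuantumFields-20520`
(`--supports … --as helper`, count-neutral); DEFINITION-FREE (0 `def`∕`instance`∕`notation`∕`sorry`); ONE decl-local `maxHeartbeats 400000` on §2 (README №24 class, the budget of
✓`Prop7HcoSOfGaugedRows.hcoS_of_gaugedRowsS`).  WHY, the row map and the residue towards the S2β letters: FILE 1∕2 ✓`…S2BetaSigmaGrowthDoor` + LOCATE-CURV-IN-19200 (20520 evidence #51).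
* §2 ★★★ `sigmaGrowth_of_normG0_of_combRemainderRows (c₀ cB a₀)` — hypotheses VERBATIM those of ✓`Prop7HcoSEndToEnd.hcoS_of_normG0_of_combRemainderRows` ((N06) = [B9] Thm 3.3∕3.11 `norm_G₀ᶜ`,
  (P-A2⁺)); proof = ★p1-19200 g18's E2E knit VERBATIM (every row by name) + ONE window summand (`kQ·e ≤ 1`), then (141) mod coarse gauge ✓`abs_lin_le_sum_norm_trueLinIter_weakEL_sub_coarseGauge`
  and FILE 1's `growth_of_QRows` (Taylor at `θ = ⅓`) ∘ `rate_arith`; CONCLUSION `∀ L > 1 ∀ B₁′ > 0 ∃ e₇ c > 0` (`c := (480·B₀(L))⁻¹`): `c·(L^{K−n})⁻²·Σ_b‖X b‖² ≤ A(W·e^{iX}) − A(W)` on the `hcoS` binder.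
* §3 ★★★ `sigmaGrowth_holds` — §2 at `c₀ = cB = a₀ = 1`, (N06) := ✓`Prop7HN06Holds.hN06_holds`, (P-A2⁺) := ✓`hPA2_of_diffL1 (hD_of_hMcomb hMcomb_holds hMc₂_holds hN2s_holds)` + the SUP row by
  ✓`Prop7CmapTwSupRow.norm_CmapTw_apply_le_of_in19` (★p1 g18's v2 derivation VERBATIM): **NO HYPOTHESIS, EVERY `L > 1`**.
HONEST SCOPE.  A re-knit of landed rows keeping the rate the original spends at `θ = ½`; nothing of Bałaban's analysis asserted beyond the cited tree theorems; credits nothing; POS∘∕`hH` on the tube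
chart, ISOL∘, TUBE-REG∘ (datum-free `δ`), GAP♯∘, EXW∘, 20520, `YM3TorusSU2` NOT proved; the Yang–Mills mass gap is NOT proved.
References: T. Bałaban, CMP **102** (1985) 277–309 [Balaban1985Variational] ((19)–(21) p.281, (44)–(47) pp.285–286, (106)–(111) p.294, (116) p.295, (141)–(143) p.299); CMP **99** (1985) 389–434
[Balaban1985BackgroundPropagators] (Thm 3.3 p.399, Thm 3.11 p.416, (3.10)–(3.12) p.392, (3.26) p.395); CMP **98** (1985) 17–51 [Balaban1985Averaging] (Prop. 4 (134)–(135) p.38, Prop. 5 (157) p.41).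
-/

set_option autoImplicit false
noncomputable section

open scoped BigOperators Matrix.Norms.L2Operator Matrix Topology InnerProductSpace
open Filter NormedSpace

namespace Summit.QuantumFields.YangMills.Theorems.FluctuationComparisonRegPrIntLS2BetaSigmaGrowthRate


open Literature.MathematicalPhysics.QuantumFieldTheory.Balaban1983to89
open Literature.MathematicalPhysics.QuantumFieldTheory.Balaban1983to89.T3ContinuumYM3Torus
open Literature.MathematicalPhysics.QuantumFieldTheory.Balaban1983to89.T3PrintedRegularMinimiser
open Literature.MathematicalPhysics.QuantumFieldTheory.Balaban1983to89.T3RegularMinimiser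


open Literature.MathematicalPhysics.QuantumFieldTheory.Balaban1983to89.T3UnitLawDensityEML (ℰp)
open Literature.MathematicalPhysics.QuantumFieldTheory.Balaban1983to89.T3ConstrainedMinimiser (fibre)
open Literature.MathematicalPhysics.QuantumFieldTheory.Balaban1983to89.T3Thm1Carrier
open T4Continuum BlockAveraging AveragingRT ExpMeanLog BlockAveragingEMLLinearised BlockAveragingEMLLinearisedBackground BlockAveragingEMLProp2
open B10Eq27TorusAxialLog (pull)
open T3SectALandauChart (emb15 eta eta_pos bgUnits In19 pos_of_regPr)
open B11Eq103H1Complex (BondL2K laplaceAK)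
open B7Prop2Explicit (C0 c2')
open B7Prop3Flat (c3)
open Summit.QuantumFields.YangMills.Theorems.Prop7SPrint (basePt RestrictedPrint AvgCondPrint IsLandauPrint)
open Summit.QuantumFields.YangMills.Theorems.Prop7TPrint (expHermField)
open Summit.QuantumFields.YangMills.Theorems.Prop7SectET3Transport (periodsT3)
open Summit.QuantumFields.YangMills.Theorems.Prop7SectET3HilbertLetters (W₂ toL2 toL2B DL2 DstarL2)
open Summit.QuantumFields.YangMills.Theorems.Prop7SectET3WilsonHessian (DeltaEta DeltaEtaSlot DeltaEtaSlot_apply)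
open Summit.QuantumFields.YangMills.Theorems.Prop7SectET3CombLetters (Qkc Qkc_toL2)
open Summit.QuantumFields.YangMills.Theorems.Prop7QprimeCombL2 (RcombL2)
open Summit.QuantumFields.YangMills.Theorems.Prop7SymAvgTw (QTw CmapTw)
open Summit.QuantumFields.YangMills.Theorems.Prop7CoerciveOfNormG0Comb (coerc_landau_RcombL2_of_normG₀_of_isLandauPrint)
open Summit.QuantumFields.YangMills.Theorems.Prop7HessOnPrintSlice (coercive_on_landau_of_coercive)
open Summit.QuantumFields.YangMills.Theorems.Prop7HcoWOfSigmaRows (hess_arith)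
open Summit.QuantumFields.YangMills.Theorems.Prop7HcoWOfSigmaRowsDiv (joint_arith)
open Summit.QuantumFields.YangMills.Theorems.Prop7SigmaE2EArith (coerc_window chart_window kappa_arith joint_window hess_window)
open Summit.QuantumFields.YangMills.Theorems.Prop7SigmaRowsNorm (c0_mul_sum_norm_sq_le_norm_sq_toL2)
open Summit.QuantumFields.YangMills.Theorems.Prop7SigmaRowsQSmall (sum_norm_sq_le_of_sup_of_sum qsmall_arith)
open Summit.QuantumFields.YangMills.Theorems.Prop7SlotRowOfDeltaEta (re_inner_DeltaEta_le_of_regPr)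
open Summit.QuantumFields.YangMills.Theorems.Prop7SigmaIdentityComb (QTw_eq_neg_CmapTw_of_sigma)
open Summit.QuantumFields.YangMills.Theorems.Prop7JointSigmaOfCmapTwL1 (jointRow_of_l1_CmapTw)
open Summit.QuantumFields.YangMills.Theorems.Prop7ChartWindows (windowsS_of_small)
open Summit.QuantumFields.YangMills.Theorems.Prop7RieszTauFrobNorm (sum_norm_sq_le_two_mul_opNorm_sq)
open Summit.QuantumFields.YangMills.Theorems.Prop7LaplaceAFlatLetters (norm_sq_toL2B)
open Summit.QuantumFields.YangMills.Theorems.Prop7SPrintIn19 (pow_mul_eta)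
open Summit.QuantumFields.YangMills.Theorems.Prop7HcoSEndToEnd (in19_mono slot_reshape qweight_reshape summand_window)
open Summit.QuantumFields.YangMills.Theorems.Prop7Taylor3Uniform (wilsonAction4_expChart_sub_lin_ge)
open Summit.QuantumFields.YangMills.Theorems.Prop7CurvedLandauRowA (exists_trueLinIter_family)
open Summit.QuantumFields.YangMills.Theorems.Prop7FirstVariationWeakEL (weakEL_of_fibreEL)
open Summit.QuantumFields.YangMills.Theorems.Prop7HcoWOfGaugedRows (abs_lin_le_sum_norm_trueLinIter_weakEL_sub_coarseGauge)
open Summit.QuantumFields.YangMills.Theorems.Prop7HN06Holds (hN06_holds)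
open Summit.QuantumFields.YangMills.Theorems.Prop7HcoSOfNormG0DiffRow (hPA2_of_diffL1)
open Summit.QuantumFields.YangMills.Theorems.Prop7HDOfCombRows (hD_of_hMcomb)
open Summit.QuantumFields.YangMills.Theorems.Prop7CombHMcombHolds (hMcomb_holds)
open Summit.QuantumFields.YangMills.Theorems.Prop7CombHMc2Holds (hMc₂_holds)
open Summit.QuantumFields.YangMills.Theorems.Prop7N32SymRow (hN2s_holds)
open Summit.QuantumFields.YangMills.Theorems.Prop7CmapTwSupRow (norm_CmapTw_apply_le_of_in19)
open Summit.QuantumFields.YangMills.Theorems.FluctuationComparisonRegPrIntLS2BetaSigmaGrowthDoor (growth_of_QRows rate_arith)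

/-! ## §2 The end-to-end knit with the rate kept -/

section E2E

variable (c₀ cB a₀ : ℕ → ℝ) [hc₀ : ∀ L : ℕ, Fact (0 < c₀ L)] [hcB : ∀ L : ℕ, Fact (0 < cB L)]

set_option maxHeartbeats 400000 in
-- hb: the E2E knit of ✓`hcoS_of_normG0_of_combRemainderRows` re-run verbatim plus one growth step (README №24 class; same budget as ✓`hcoS_of_gaugedRowsS`).
/-- ★★★ **(142) WITH ITS RATE ON THE Σ-SLICE FROM (N06) ∧ (P-A2⁺), EVERYTHING ELSE BY NAME** — hypotheses VERBATIM those of ✓`Prop7HcoSEndToEnd.hcoS_of_normG0_of_combRemainderRows`; conclusion `∀ L > 1 ∀ B₁′ > 0 ∃ e₇ c > 0` (`c = (480·B₀)⁻¹`), `c·(L^{K−n})⁻²·Σ_b‖X b‖² ≤ A(W·e^{iX}) − A(W)` on the `hcoS` binder. [cite: Balaban1985Variational, (141)-(143) p.299, (19)-(21) p.281, (44)-(47) pp.285-286; Balaban1985BackgroundPropagators, Thm 3.11 p.416, Thm 3.3 p.399, (3.10)-(3.12) p.392] -/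
theorem sigmaGrowth_of_normG0_of_combRemainderRows (ha₀ : ∀ L : ℕ, 0 ≤ a₀ L)
    (hN06 : ∀ (L : ℕ), 1 < L → ∃ B₀ eN : ℝ, 0 < B₀ ∧ 0 < eN ∧
      ∀ (F : T3Family), F.L = L → ∀ (n K : ℕ) (hnK : n < K) (e : ℝ) (W : GaugeField (F.P K) 0 (Matrix.specialUnitaryGroup (Fin 2) ℂ)),
        0 < e → e ≤ eN → RegPr F n K e W →
        ∃ G₀ : BondL2K ℂ 3 (periodsT3 F K) (c₀ F.L) W₂ →ₗ[ℂ] BondL2K ℂ 3 (periodsT3 F K) (c₀ F.L) W₂,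
          laplaceAK (DeltaEtaSlot F n K (c₀ F.L) W) (DL2 F n K (c₀ F.L) W) (RcombL2 F n K (c₀ F.L) W) (DstarL2 F n K (c₀ F.L) W)
              (Qkc F n K hnK.le (c₀ F.L) (cB F.L) W) (LinearMap.adjoint (Qkc F n K hnK.le (c₀ F.L) (cB F.L) W))
              (((a₀ F.L * (c₀ F.L / cB F.L) * ((F.L : ℝ) ^ (K - n)) ^ 3 : ℝ) : ℂ)) ∘ₗ G₀ = LinearMap.id ∧
          ∀ f, ‖G₀ f‖ ≤ B₀ * ‖f‖)
    (hPA2 : ∀ (L : ℕ), 1 < L → ∀ (B₁' : ℝ), 0 < B₁' → ∃ eJ kσ C₁ C₂ ζ δ₁ : ℝ, 0 < eJ ∧ 0 ≤ kσ ∧ 0 ≤ C₁ ∧ 0 ≤ C₂ ∧ 0 ≤ ζ ∧ 0 ≤ δ₁ ∧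
      ∀ (F : T3Family), F.L = L → ∀ (n K : ℕ) (hnK : n < K) (e : ℝ) (V : GaugeField (F.P n) 0 (Matrix.specialUnitaryGroup (Fin 2) ℂ))
        (W : GaugeField (F.P K) 0 (Matrix.specialUnitaryGroup (Fin 2) ℂ)) (X : PBond (F.P K) 0 → Matrix (Fin 2) (Fin 2) ℂ),
        0 < e → e ≤ eJ → W ∈ regFibrePr F n K hnK.le e V →
        (∀ γ : ℝ → GaugeField (F.P K) 0 (Matrix.specialUnitaryGroup (Fin 2) ℂ), γ 0 = W → (∀ t, γ t ∈ fibre F ℰp n K hnK.le V) →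
          (∀ b, DifferentiableAt ℝ (fun t => ((γ t b : Matrix.specialUnitaryGroup (Fin 2) ℂ) : Matrix (Fin 2) (Fin 2) ℂ)) 0) →
            deriv (fun t => wilsonAction4 (γ t)) 0 = 0) →
        In19 F n K (2 * B₁' * e) W (expHermField X) X → AvgCondPrint F n K hnK.le V W X → IsLandauPrint F n K W X →
          (∀ ĉ : PBond (F.P n) 0, ‖CmapTw F n K hnK.le W (fun b => Complex.I • X b) ĉ‖ ≤ kσ * e) ∧
          ∃ dv : ℝ, ∑ ĉ : PBond (F.P n) 0, ‖CmapTw F n K hnK.le W (fun b => Complex.I • X b) ĉ‖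
              ≤ C₁ * ((F.L : ℝ) ^ (K - n))⁻¹ * (∑ b : PBond (F.P K) 0, ‖X b‖ ^ 2) + C₂ * ((F.L : ℝ) ^ (K - n)) * ((∑ p : Plaq (F.P K) 0, ‖((Complex.I • X ⟨p.src, p.μ⟩) + ((W ⟨p.src, p.μ⟩ : Matrix (Fin 2) (Fin 2) ℂ) * (Complex.I • X ⟨p.src.shift p.μ, p.ν⟩) * star (W ⟨p.src, p.μ⟩ : Matrix (Fin 2) (Fin 2) ℂ))
            - (((W ⟨p.src, p.μ⟩ * W ⟨p.src.shift p.μ, p.ν⟩ * (W ⟨p.src.shift p.ν, p.μ⟩)⁻¹ : Matrix.specialUnitaryGroup (Fin 2) ℂ) : Matrix (Fin 2) (Fin 2) ℂ) * (Complex.I • X ⟨p.src.shift p.ν, p.μ⟩) * star ((W ⟨p.src, p.μ⟩ * W ⟨p.src.shift p.μ, p.ν⟩ * (W ⟨p.src.shift p.ν, p.μ⟩)⁻¹ : Matrix.specialUnitaryGroup (Fin 2) ℂ) : Matrix (Fin 2) (Fin 2) ℂ))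
            - (((GaugeField.plaqHol W p : Matrix.specialUnitaryGroup (Fin 2) ℂ) : Matrix (Fin 2) (Fin 2) ℂ) * (Complex.I • X ⟨p.src, p.ν⟩) * star ((GaugeField.plaqHol W p : Matrix.specialUnitaryGroup (Fin 2) ℂ) : Matrix (Fin 2) (Fin 2) ℂ)))‖ ^ 2) + dv) ∧
            dv ≤ ζ * (∑ p : Plaq (F.P K) 0, ‖((Complex.I • X ⟨p.src, p.μ⟩) + ((W ⟨p.src, p.μ⟩ : Matrix (Fin 2) (Fin 2) ℂ) * (Complex.I • X ⟨p.src.shift p.μ, p.ν⟩) * star (W ⟨p.src, p.μ⟩ : Matrix (Fin 2) (Fin 2) ℂ))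
            - (((W ⟨p.src, p.μ⟩ * W ⟨p.src.shift p.μ, p.ν⟩ * (W ⟨p.src.shift p.ν, p.μ⟩)⁻¹ : Matrix.specialUnitaryGroup (Fin 2) ℂ) : Matrix (Fin 2) (Fin 2) ℂ) * (Complex.I • X ⟨p.src.shift p.ν, p.μ⟩) * star ((W ⟨p.src, p.μ⟩ * W ⟨p.src.shift p.μ, p.ν⟩ * (W ⟨p.src.shift p.ν, p.μ⟩)⁻¹ : Matrix.specialUnitaryGroup (Fin 2) ℂ) : Matrix (Fin 2) (Fin 2) ℂ))
            - (((GaugeField.plaqHol W p : Matrix.specialUnitaryGroup (Fin 2) ℂ) : Matrix (Fin 2) (Fin 2) ℂ) * (Complex.I • X ⟨p.src, p.ν⟩) * star ((GaugeField.plaqHol W p : Matrix.specialUnitaryGroup (Fin 2) ℂ) : Matrix (Fin 2) (Fin 2) ℂ)))‖ ^ 2) + δ₁ * (((F.L : ℝ) ^ (K - n)) ^ 2)⁻¹ * (∑ b : PBond (F.P K) 0, ‖X b‖ ^ 2)) :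
    ∀ (L : ℕ), 1 < L → ∀ (B₁' : ℝ), 0 < B₁' → ∃ e₇ c : ℝ, 0 < e₇ ∧ 0 < c ∧
      ∀ (F : T3Family), F.L = L → ∀ (n K : ℕ) (hnK : n < K) (e : ℝ) (V : GaugeField (F.P n) 0 (Matrix.specialUnitaryGroup (Fin 2) ℂ))
        (W : GaugeField (F.P K) 0 (Matrix.specialUnitaryGroup (Fin 2) ℂ)) (X : PBond (F.P K) 0 → Matrix (Fin 2) (Fin 2) ℂ),
        0 < e → e ≤ e₇ → W ∈ regFibrePr F n K hnK.le e V →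
        (∀ γ : ℝ → GaugeField (F.P K) 0 (Matrix.specialUnitaryGroup (Fin 2) ℂ), γ 0 = W → (∀ t, γ t ∈ fibre F ℰp n K hnK.le V) →
          (∀ b, DifferentiableAt ℝ (fun t => ((γ t b : Matrix.specialUnitaryGroup (Fin 2) ℂ) : Matrix (Fin 2) (Fin 2) ℂ)) 0) →
            deriv (fun t => wilsonAction4 (γ t)) 0 = 0) →
        In19 F n K (2 * B₁' * e) W (expHermField X) X → AvgCondPrint F n K hnK.le V W X → IsLandauPrint F n K W X →
          c * (((F.L : ℝ) ^ (K - n)) ^ 2)⁻¹ * (∑ b : PBond (F.P K) 0, ‖X b‖ ^ 2)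
            ≤ wilsonAction4 (emb15 W (expHermField X)) - wilsonAction4 W := by
  intro L hL B₁' hB₁'
  obtain ⟨B₀, eN, hB₀, heN, HN⟩ := hN06 L hL
  obtain ⟨eJ, kσ, C₁, C₂, ζ, δ₁, heJ, hkσ, hC₁, hC₂, hζ, hδ₁, HJ⟩ := hPA2 L hL B₁' hB₁'
  have ha₀L := ha₀ L
  obtain ⟨kQ, hkQ_def⟩ : ∃ kQ : ℝ, kQ = 2 * a₀ L * kσ * (C₂ * (1 + ζ)) := ⟨_, rfl⟩
  obtain ⟨kQ', hkQ'_def⟩ : ∃ kQ' : ℝ, kQ' = 2 * a₀ L * kσ * (C₁ + C₂ * δ₁) := ⟨_, rfl⟩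
  have hkQ : 0 ≤ kQ := by rw [hkQ_def]; positivity
  have hkQ' : 0 ≤ kQ' := by rw [hkQ'_def]; positivity
  have hL0 : (0 : ℝ) < (L : ℝ) := by exact_mod_cast (show 0 < L by omega)
  obtain ⟨T, hT_def⟩ : ∃ T : ℝ, T = 2058 * B₀ + 8 * B₁' + 2 * B₀ * (2442 + kQ' + 1)
      + 16 * B₀ * (4 + kQ) * (2 * (C₁ + C₂ * δ₁) + 62208 * B₁' ^ 2 + 217) + (16 * (C₂ * (1 + ζ)) + 1)
      + 10 ^ 10 * (L : ℝ) ^ 6 + 10 ^ 9 * (2 * B₁' + 1) * (L : ℝ) ^ 2 + 178 * 10 ^ 7 * (2 * B₁' + 1) * (L : ℝ) ^ 3 + kQ := ⟨_, rfl⟩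
  have t1 : (0 : ℝ) ≤ 2058 * B₀ := by positivity
  have t2 : (0 : ℝ) ≤ 8 * B₁' := by positivity
  have t3 : (0 : ℝ) ≤ 2 * B₀ * (2442 + kQ' + 1) := by positivity
  have t4 : (0 : ℝ) ≤ 16 * B₀ * (4 + kQ) * (2 * (C₁ + C₂ * δ₁) + 62208 * B₁' ^ 2 + 217) := by positivity
  have t5 : (0 : ℝ) ≤ 16 * (C₂ * (1 + ζ)) + 1 := by positivity
  have t6 : (0 : ℝ) ≤ 10 ^ 10 * (L : ℝ) ^ 6 := by positivity
  have t7 : (0 : ℝ) ≤ 10 ^ 9 * (2 * B₁' + 1) * (L : ℝ) ^ 2 := by positivity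
  have t8 : (0 : ℝ) ≤ 178 * 10 ^ 7 * (2 * B₁' + 1) * (L : ℝ) ^ 3 := by positivity
  have t9 : (0 : ℝ) ≤ kQ := hkQ
  have hTpos : 0 < T := by rw [hT_def]; linarith [hB₀]
  have hcpos : (0 : ℝ) < (480 * B₀)⁻¹ := by positivity
  refine ⟨min eN (min eJ (min 1 T⁻¹)), (480 * B₀)⁻¹, lt_min heN (lt_min heJ (lt_min one_pos (inv_pos.mpr hTpos))), hcpos, ?_⟩
  intro F hF n K hnK e V W X he heε hWreg hEL h19 h20 h21
  have heN' : e ≤ eN := heε.trans (min_le_left _ _)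
  have heJ' : e ≤ eJ := (heε.trans (min_le_right _ _)).trans (min_le_left _ _)
  have he1 : e ≤ 1 := ((heε.trans (min_le_right _ _)).trans (min_le_right _ _)).trans (min_le_left _ _)
  have hTe : T * e ≤ 1 := by
    have h := ((heε.trans (min_le_right _ _)).trans (min_le_right _ _)).trans (min_le_right _ _)
    calc T * e ≤ T * T⁻¹ := mul_le_mul_of_nonneg_left h hTpos.le
      _ = 1 := mul_inv_cancel₀ hTpos.ne'
  have w1 : 2058 * B₀ * e ≤ 1 := summand_window (by rw [hT_def]; linarith) he.le hTe
  have w2 : 8 * B₁' * e ≤ 1 := summand_window (by rw [hT_def]; linarith) he.le hTe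
  have w3 : 2 * B₀ * (2442 + kQ' + 1) * e ≤ 1 := summand_window (by rw [hT_def]; linarith) he.le hTe
  have w4 : 16 * B₀ * (4 + kQ) * (2 * (C₁ + C₂ * δ₁) + 62208 * B₁' ^ 2 + 217) * e ≤ 1 := summand_window (by rw [hT_def]; linarith) he.le hTe
  have w5 : (16 * (C₂ * (1 + ζ)) + 1) * e ≤ 1 := summand_window (by rw [hT_def]; linarith) he.le hTe
  have w6 : 10 ^ 10 * (L : ℝ) ^ 6 * e ≤ 1 := summand_window (by rw [hT_def]; linarith) he.le hTe
  have w7 : 10 ^ 9 * (2 * B₁' + 1) * (L : ℝ) ^ 2 * e ≤ 1 := summand_window (by rw [hT_def]; linarith) he.le hTe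
  have w8 : 178 * 10 ^ 7 * (2 * B₁' + 1) * (L : ℝ) ^ 3 * e ≤ 1 := summand_window (by rw [hT_def]; linarith) he.le hTe
  have w9 : kQ * e ≤ 1 := summand_window (by rw [hT_def]; linarith) he.le hTe
  subst hF
  have hL1 : (1 : ℝ) ≤ (F.L : ℝ) := by exact_mod_cast hL.le
  have hℓpos : (0 : ℝ) < (F.L : ℝ) ^ (K - n) := by positivity
  have hℓ1 : (1 : ℝ) ≤ (F.L : ℝ) ^ (K - n) := one_le_pow₀ hL1
  have hc₀ : (0 : ℝ) < c₀ F.L := (hc₀ F.L).out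
  have hcB : (0 : ℝ) < cB F.L := (hcB F.L).out
  have hPL : (((F.P K).L : ℕ) : ℝ) = (F.L : ℝ) := rfl
  have hη : eta F n K = ((F.L : ℝ) ^ (K - n))⁻¹ := by rw [eta, inv_pow]
  have hηpos : 0 < eta F n K := eta_pos F n K
  have hη1 : eta F n K ≤ 1 := by rw [hη]; exact inv_le_one_of_one_le₀ hℓ1
  have hℓη : (F.L : ℝ) ^ (K - n) * eta F n K = 1 := by rw [hη]; exact mul_inv_cancel₀ hℓpos.ne'
  have hrT : regThreshold F n K e = e * eta F n K ^ 2 := by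
    show e * ((F.L : ℝ)⁻¹) ^ (2 * (K - n)) = _
    rw [eta, pow_mul']
  have hrT' : regThreshold F n K e = e * (((F.L : ℝ) ^ (K - n)) ^ 2)⁻¹ := by rw [hrT, hη, inv_pow]
  obtain ⟨hWfib, hreg⟩ := (mem_regFibrePr_iff F).mp hWreg
  -- the radius of (19) for the Σ-identity: `ε₂ := (2B₁′ + 1)e ≥ e`
  have hε₂pos : 0 < (2 * B₁' + 1) * e := by positivity
  have h2B : 2 * B₁' * e ≤ (2 * B₁' + 1) * e := by rw [add_mul, one_mul]; exact le_add_of_nonneg_right he.le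
  have heε₂ : e ≤ (2 * B₁' + 1) * e := by
    rw [add_mul, one_mul]; exact le_add_of_nonneg_left (by positivity)
  have h19' : In19 F n K ((2 * B₁' + 1) * e) W (expHermField X) X := in19_mono h2B h19
  -- the L-only windows of the chart letters (✓`windowsS_of_small` at `(α, e) := (e, ε₂)`)
  have hL2le6 : (F.L : ℝ) ^ 2 ≤ (F.L : ℝ) ^ 6 := pow_le_pow_right₀ hL1 (by norm_num)
  have hL3le6 : (F.L : ℝ) ^ 3 ≤ (F.L : ℝ) ^ 6 := pow_le_pow_right₀ hL1 (by norm_num)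
  have heL6 : e * (F.L : ℝ) ^ 6 ≤ 1 / 10 ^ 10 := by
    rw [le_div_iff₀ (by positivity)]
    calc e * (F.L : ℝ) ^ 6 * 10 ^ 10 = 10 ^ 10 * (F.L : ℝ) ^ 6 * e := by ring
      _ ≤ 1 := w6
  have hαw : e * (((F.P K).L : ℕ) : ℝ) ^ 2 ≤ 1 / 10 ^ 9 := by
    rw [hPL]
    have h1 : e * (F.L : ℝ) ^ 2 ≤ e * (F.L : ℝ) ^ 6 := mul_le_mul_of_nonneg_left hL2le6 he.le
    linarith
  have hεw : (2 * B₁' + 1) * e * (((F.P K).L : ℕ) : ℝ) ^ 2 ≤ 1 / 10 ^ 9 := by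
    rw [hPL, le_div_iff₀ (by positivity)]
    calc (2 * B₁' + 1) * e * (F.L : ℝ) ^ 2 * 10 ^ 9 = 10 ^ 9 * (2 * B₁' + 1) * (F.L : ℝ) ^ 2 * e := by ring
      _ ≤ 1 := w7
  obtain ⟨hα3, hα4', -, hε20, hsmall, hc₃, hsm, -, -⟩ := windowsS_of_small F K he hε₂pos hαw hεw
  have hα4 : 4 * e ≤ c2' (F.P K).d (F.P K).L := by linarith
  have hε₂4 : (2 * B₁' + 1) * e ≤ 1 / 4 := hε20.trans (by norm_num)
  have he10 : 10 ^ 10 * (F.L : ℝ) ^ 6 * e ≤ 1 := w6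
  have he7 : 10 ^ 7 * (F.L : ℝ) ^ 3 * e ≤ 1 := by
    have h1 : (10 : ℝ) ^ 7 * (F.L : ℝ) ^ 3 ≤ 10 ^ 10 * (F.L : ℝ) ^ 6 :=
      mul_le_mul (by norm_num) hL3le6 (by positivity) (by positivity)
    exact (mul_le_mul_of_nonneg_right h1 he.le).trans w6
  have h178 : 10 ^ 7 * (F.L : ℝ) ^ 3 * (178 * ((2 * B₁' + 1) * e)) ≤ 1 := by
    calc 10 ^ 7 * (F.L : ℝ) ^ 3 * (178 * ((2 * B₁' + 1) * e)) = 178 * 10 ^ 7 * (2 * B₁' + 1) * (F.L : ℝ) ^ 3 * e := by ring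
      _ ≤ 1 := w8
  have he6 : 10 ^ 6 * (F.L : ℝ) ^ 2 * ((2 * B₁' + 1) * e) ≤ 1 := by
    have h0 : 0 ≤ (2 * B₁' + 1) * (F.L : ℝ) ^ 2 * e := by positivity
    calc 10 ^ 6 * (F.L : ℝ) ^ 2 * ((2 * B₁' + 1) * e) = 10 ^ 6 * ((2 * B₁' + 1) * (F.L : ℝ) ^ 2 * e) := by ring
      _ ≤ 10 ^ 9 * ((2 * B₁' + 1) * (F.L : ℝ) ^ 2 * e) := mul_le_mul_of_nonneg_right (by norm_num) h0
      _ = 10 ^ 9 * (2 * B₁' + 1) * (F.L : ℝ) ^ 2 * e := by ring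
      _ ≤ 1 := w7
  -- (COERC) ∧ (LANDAU-S) at the comb slots of record from the N06 datum (★w1 g14 ✓p695339)
  obtain ⟨G₀, hG, hGB⟩ := HN F rfl n K hnK e W he heN' hreg
  have haQ : 0 ≤ a₀ F.L * (c₀ F.L / cB F.L) * ((F.L : ℝ) ^ (K - n)) ^ 3 := by positivity
  obtain ⟨hco, hLS⟩ := coerc_landau_RcombL2_of_normG₀_of_isLandauPrint F hnK.le (c₀ F.L) (cB F.L)
    (a₀ F.L * (c₀ F.L / cB F.L) * ((F.L : ℝ) ^ (K - n)) ^ 3) he hα3 hα4 W hreg haQ hB₀ (coerc_window w1) G₀ hG hGB h21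
  -- HESS on print's slice: `γ‖X̃‖² − aQ‖Q_k X̃‖² ≤ re⟪X̃, Δ^η X̃⟫`
  have h1 : B₀⁻¹ * ‖toL2 F K (c₀ F.L) X‖ ^ 2
      - (a₀ F.L * (c₀ F.L / cB F.L) * ((F.L : ℝ) ^ (K - n)) ^ 3) * ‖Qkc F n K hnK.le (c₀ F.L) (cB F.L) W (toL2 F K (c₀ F.L) X)‖ ^ 2
        ≤ RCLike.re ⟪toL2 F K (c₀ F.L) X, DeltaEta F n K (c₀ F.L) W (toL2 F K (c₀ F.L) X)⟫_ℂ := by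
    have h0 := coercive_on_landau_of_coercive (DeltaEtaSlot F n K (c₀ F.L) W) (DL2 F n K (c₀ F.L) W) (RcombL2 F n K (c₀ F.L) W)
      (DstarL2 F n K (c₀ F.L) W) (Qkc F n K hnK.le (c₀ F.L) (cB F.L) W) (LinearMap.adjoint (Qkc F n K hnK.le (c₀ F.L) (cB F.L) W))
      (((a₀ F.L * (c₀ F.L / cB F.L) * ((F.L : ℝ) ^ (K - n)) ^ 3 : ℝ) : ℂ)) rfl hco hLS
    have ha : RCLike.re (((a₀ F.L * (c₀ F.L / cB F.L) * ((F.L : ℝ) ^ (K - n)) ^ 3 : ℝ) : ℂ))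
        = a₀ F.L * (c₀ F.L / cB F.L) * ((F.L : ℝ) ^ (K - n)) ^ 3 := by rw [RCLike.re_to_complex, Complex.ofReal_re]
    rw [ha, DeltaEtaSlot_apply] at h0
    exact h0
  have hN := c0_mul_sum_norm_sq_le_norm_sq_toL2 F K (c₀ F.L) X
  -- (SLOT) ★px5 ✓p689967, reshaped to `kK = 4`, `kE = 2442`
  have hM : (0 : ℝ) ≤ ∑ b : PBond (F.P K) 0, ‖X b‖ ^ 2 := Finset.sum_nonneg fun b _ => by positivity
  have hSl0 := re_inner_DeltaEta_le_of_regPr (c₀ := c₀ F.L) he.le W hreg X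
  simp only [Pi.smul_apply] at hSl0
  rw [hrT] at hSl0
  have hSl := slot_reshape hc₀.le hηpos hη1 hℓη he.le he1 hM hSl0
  -- (QSMALL) — fourth order: `aQ‖Q_k X̃‖² ≤ 2a₀c₀ℓ·Σ_ĉ‖C(W,iX)ĉ‖²`, then the sup and `ℓ¹` rows (✓`qsmall_arith`)
  obtain ⟨hsup, dv, hbind, hdv⟩ := HJ F rfl n K hnK e V W X he heJ' hWreg hEL h19 h20 h21
  have hSig := QTw_eq_neg_CmapTw_of_sigma F hnK.le he hε₂pos heε₂ hε₂4 he7 h178 he6 hα3 hα4' hsmall hc₃ hsm hWreg h19' h20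
  have hQC : ∀ ĉ : PBond (F.P n) 0, ‖QTw F n K hnK.le W X ĉ‖ = ‖CmapTw F n K hnK.le W (fun b => Complex.I • X b) ĉ‖ := by
    intro ĉ
    have hc := congrFun hSig ĉ
    have hI : QTw F n K hnK.le W (fun b => Complex.I • X b) = Complex.I • QTw F n K hnK.le W X :=
      (QTw F n K hnK.le W).map_smul Complex.I X
    rw [hI, Pi.smul_apply, Pi.neg_apply] at hc
    rw [← norm_neg (CmapTw F n K hnK.le W (fun b => Complex.I • X b) ĉ), ← hc, norm_smul, Complex.norm_I, one_mul]
  have hQn : (a₀ F.L * (c₀ F.L / cB F.L) * ((F.L : ℝ) ^ (K - n)) ^ 3) * ‖Qkc F n K hnK.le (c₀ F.L) (cB F.L) W (toL2 F K (c₀ F.L) X)‖ ^ 2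
      ≤ (2 * a₀ F.L * c₀ F.L * (F.L : ℝ) ^ (K - n)) * ∑ ĉ : PBond (F.P n) 0, ‖CmapTw F n K hnK.le W (fun b => Complex.I • X b) ĉ‖ ^ 2 := by
    have hB : ‖toL2B F n (cB F.L) (QTw F n K hnK.le W X)‖ ^ 2
        ≤ cB F.L * (2 * ∑ ĉ : PBond (F.P n) 0, ‖CmapTw F n K hnK.le W (fun b => Complex.I • X b) ĉ‖ ^ 2) := by
      rw [norm_sq_toL2B]
      refine mul_le_mul_of_nonneg_left ?_ hcB.le
      rw [Finset.mul_sum]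
      refine Finset.sum_le_sum fun ĉ _ => ?_
      rw [← hQC ĉ]
      exact sum_norm_sq_le_two_mul_opNorm_sq _
    have hnorm : ‖Qkc F n K hnK.le (c₀ F.L) (cB F.L) W (toL2 F K (c₀ F.L) X)‖ ^ 2 = eta F n K ^ 2 * ‖toL2B F n (cB F.L) (QTw F n K hnK.le W X)‖ ^ 2 := by
      rw [Qkc_toL2, norm_smul, Complex.norm_real, Real.norm_of_nonneg hηpos.le, mul_pow]
    rw [hnorm, ← qweight_reshape hcB.ne' hℓη]
    exact mul_le_mul_of_nonneg_left (mul_le_mul_of_nonneg_left hB (by positivity)) haQ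
  have hA : 0 ≤ 2 * a₀ F.L * c₀ F.L * (F.L : ℝ) ^ (K - n) := by positivity
  have hQ0 := qsmall_arith hA (by positivity : 0 ≤ kσ * e) hℓpos hC₂
    (sum_norm_sq_le_of_sup_of_sum (fun ĉ => CmapTw F n K hnK.le W (fun b => Complex.I • X b) ĉ) hsup) hbind hdv
  have hq1 : 2 * a₀ F.L * c₀ F.L * (F.L : ℝ) ^ (K - n) * (kσ * e) * (C₂ * (1 + ζ)) * (F.L : ℝ) ^ (K - n)
      = kQ * c₀ F.L * e * ((F.L : ℝ) ^ (K - n)) ^ 2 := by rw [hkQ_def]; ring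
  have hq2 : 2 * a₀ F.L * c₀ F.L * (F.L : ℝ) ^ (K - n) * (kσ * e) * (C₁ + C₂ * δ₁) * (F.L : ℝ) ^ (K - n)
      = kQ' * c₀ F.L * e * ((F.L : ℝ) ^ (K - n)) ^ 2 := by rw [hkQ'_def]; ring
  rw [hq1, hq2] at hQ0
  have hQ := hQn.trans hQ0
  -- `κ` and the HESS row `κ·M ≤ K` (✓`kappa_arith`, ✓`hess_arith`)
  obtain ⟨hposK, hκ⟩ := kappa_arith (B₀ := B₀) (kE := (2442 : ℝ)) (kQ' := kQ') (kK := (4 : ℝ)) (kQ := kQ) (by norm_num) hkQ hc₀ he hℓpos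
  have hHESS := hess_arith hM (inv_pos.mpr hB₀).le h1 hN hSl hQ hposK hκ
  -- (JOINT) in the gauged door's currency (★routeR-w2 ✓`jointRow_of_l1_CmapTw` ∘ ✓`joint_arith`)
  have hJ := jointRow_of_l1_CmapTw F hnK.le he hε₂pos heε₂ hε₂4 he10 h178 he6 hα3 hα4' hsmall hc₃ hsm hWreg h19' h20 hbind
  -- CHART from (19): the sup radius `s := 2B₁′e·ℓ⁻¹`, `4s ≤ 1`
  have hDs : ∀ b : PBond (F.P K) 0, ‖X b‖ ≤ 2 * B₁' * e * ((F.L : ℝ) ^ (K - n))⁻¹ := by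
    intro b
    have hb := (In19.norm_lt h19 b).le
    rw [inv_pow] at hb
    exact hb
  have hs4 := chart_window hB₁' he hℓ1 w2
  -- the Σ-representative `X` is Hermitian-traceless ((19))
  have hDh : ∀ b : PBond (F.P K) 0, (X b).IsHermitian ∧ Matrix.trace (X b) = 0 := h19.1
  -- (141) MODULO COARSE GAUGE at the E–L-critical `W` (as in ✓`hcoS_of_gaugedRowsS`)
  obtain ⟨Q, hQ0, hQs⟩ := exists_trueLinIter_family (N := 2) W
  obtain ⟨μ, hμ, hJμ⟩ := hJ Q hQ0 hQs
  have hELQ := abs_lin_le_sum_norm_trueLinIter_weakEL_sub_coarseGauge F hnK.le hWfib (weakEL_of_fibreEL F hnK.le hEL) he he10 hreg Q hQ0 hQs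
    (fun b => Complex.I • X b)
    (fun b => by
      rw [skewAdjoint.mem_iff, star_smul, Complex.star_def, Complex.conj_I, Matrix.star_eq_conjTranspose, (hDh b).1.eq, neg_smul])
    (fun b => by rw [Matrix.trace_smul, (hDh b).2, smul_zero])
    μ (fun y => (hμ y).1) (fun y => (hμ y).2)
  beta_reduce at hELQ
  have hw₁ := joint_window he w5
  have hw₂ : 2 * e * (C₁ + C₂ * δ₁) * (((F.L : ℝ) ^ (K - n)) ^ 2)⁻¹ + 15552 * (2 * B₁' * e * ((F.L : ℝ) ^ (K - n))⁻¹) ^ 2 + 216 * regThreshold F n K e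
      ≤ (B₀⁻¹ - (2442 + kQ') * e) / ((4 + kQ * e) * ((F.L : ℝ) ^ (K - n)) ^ 2) / 8 := by
    rw [hrT']
    exact hess_window hB₀ (by norm_num) hkQ hC₁ hC₂ hδ₁ hB₁' he hℓpos he1 w3 w4
  -- (142) WITH ITS RATE on the Σ-slice (§1 at `θ = 1∕3`)
  have hgrow := growth_of_QRows F he.le (by positivity : (0 : ℝ) ≤ C₁ + C₂ * δ₁) hreg X hDh hDs hs4 hELQ (hJμ.trans (joint_arith hℓpos hC₂ hdv)) hHESS hw₁ hw₂
  -- the rate: `κ∕48 ≥ (480·B₀)⁻¹·ℓ⁻²`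
  have hκlow := rate_arith hB₀ hkQ hkQ' he hℓpos w3 w9
  have hM0 : (0 : ℝ) ≤ ∑ b : PBond (F.P K) 0, ‖X b‖ ^ 2 := Finset.sum_nonneg fun _ _ => sq_nonneg _
  calc (480 * B₀)⁻¹ * (((F.L : ℝ) ^ (K - n)) ^ 2)⁻¹ * (∑ b : PBond (F.P K) 0, ‖X b‖ ^ 2)
      ≤ (B₀⁻¹ - (2442 + kQ') * e) / ((4 + kQ * e) * ((F.L : ℝ) ^ (K - n)) ^ 2) / 48 * (∑ b : PBond (F.P K) 0, ‖X b‖ ^ 2) :=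
        mul_le_mul_of_nonneg_right hκlow hM0
    _ ≤ wilsonAction4 (emb15 W (expHermField X)) - wilsonAction4 W := hgrow

end E2E


/-! ## §3 ZERO HYPOTHESES: both rows discharged by name -/
/-- ★★★ **[Balaban1985Variational] (142) WITH ITS K-UNIFORM RATE ON THE LANDAU Σ-SLICE — NO HYPOTHESIS, EVERY `L > 1`**: §2 at `c₀ = cB = a₀ = 1` with (N06) := ✓`Prop7HN06Holds.hN06_holds` ([B9] Thm 3.11, lane II of the EX chain) and (P-A2⁺) := ✓`hPA2_of_diffL1 (hD_of_hMcomb hMcomb_holds hMc₂_holds hN2s_holds)` + the SUP row of ✓`norm_CmapTw_apply_le_of_in19` (v2 derivation VERBATIM).  For every `L > 1`, `B₁′ > 0` there are `e₇, c > 0` such that at every member `(F, n < K)`, datum `V`, every `W ∈ regFibrePr F n K e V` (`0 < e ≤ e₇`) E–L-critical along differentiable fibre curves, and every `X` with (19) `In19 F n K (2B₁′e) W (expHermField X) X`, (20) `AvgCondPrint`, (21) `IsLandauPrint`: `c·(L^{K−n})⁻²·Σ_b‖X b‖² ≤ A(W·e^{iX}) − A(W)`. [cite: Balaban1985Variational,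 (141)-(143) p.299; Balaban1985BackgroundPropagators, Thm 3.11 p.416] -/
theorem sigmaGrowth_holds :
    ∀ (L : ℕ), 1 < L → ∀ (B₁' : ℝ), 0 < B₁' → ∃ e₇ c : ℝ, 0 < e₇ ∧ 0 < c ∧
      ∀ (F : T3Family), F.L = L → ∀ (n K : ℕ) (hnK : n < K) (e : ℝ) (V : GaugeField (F.P n) 0 (Matrix.specialUnitaryGroup (Fin 2) ℂ))
        (W : GaugeField (F.P K) 0 (Matrix.specialUnitaryGroup (Fin 2) ℂ)) (X : PBond (F.P K) 0 → Matrix (Fin 2) (Fin 2) ℂ),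
        0 < e → e ≤ e₇ → W ∈ regFibrePr F n K hnK.le e V →
        (∀ γ : ℝ → GaugeField (F.P K) 0 (Matrix.specialUnitaryGroup (Fin 2) ℂ), γ 0 = W → (∀ t, γ t ∈ fibre F ℰp n K hnK.le V) →
          (∀ b, DifferentiableAt ℝ (fun t => ((γ t b : Matrix.specialUnitaryGroup (Fin 2) ℂ) : Matrix (Fin 2) (Fin 2) ℂ)) 0) →
            deriv (fun t => wilsonAction4 (γ t)) 0 = 0) →
        In19 F n K (2 * B₁' * e) W (expHermField X) X → AvgCondPrint F n K hnK.le V W X → IsLandauPrint F n K W X →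
          c * (((F.L : ℝ) ^ (K - n)) ^ 2)⁻¹ * (∑ b : PBond (F.P K) 0, ‖X b‖ ^ 2)
            ≤ wilsonAction4 (emb15 W (expHermField X)) - wilsonAction4 W := by
  haveI h1 : ∀ L : ℕ, Fact (0 < (fun _ : ℕ => (1 : ℝ)) L) := fun _ => ⟨one_pos⟩
  refine sigmaGrowth_of_normG0_of_combRemainderRows (fun _ => (1 : ℝ)) (fun _ => (1 : ℝ)) (fun _ => (1 : ℝ)) (fun _ => zero_le_one)
    (hN06_holds (fun _ => (1 : ℝ)) (fun _ => (1 : ℝ)) (fun _ => (1 : ℝ)) (fun _ _ => one_pos)) ?_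
  -- the (P-A2⁺) binder: (β) by name, then the SUP row by ✓`norm_CmapTw_apply_le_of_in19` (★p1 g18's v2 derivation VERBATIM)
  have hPA2 := hPA2_of_diffL1 (hD_of_hMcomb hMcomb_holds hMc₂_holds hN2s_holds)
  intro L hL B₁' hB₁'
  obtain ⟨eJ, C₁, C₂, ζ, δ₁, heJ, hC₁, hC₂, hζ, hδ₁, HJ⟩ := hPA2 L hL B₁' hB₁'
  have hL0 : (0 : ℝ) < (L : ℝ) := by exact_mod_cast (show 0 < L by omega)
  -- the L-only window constant of §1 at `(ε₀, ε₂) := (e, (2B₁′+1)e)`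
  obtain ⟨T, hT_def⟩ : ∃ T : ℝ, T = 10 ^ 7 * (L : ℝ) ^ 3 + 10 ^ 9 * (L : ℝ) ^ 2 + 2 * 10 ^ 9 * (2 * B₁' + 1) * (L : ℝ) ^ 2 := ⟨_, rfl⟩
  have t1 : (0 : ℝ) ≤ 10 ^ 7 * (L : ℝ) ^ 3 := by positivity
  have t2 : (0 : ℝ) ≤ 10 ^ 9 * (L : ℝ) ^ 2 := by positivity
  have t3 : (0 : ℝ) ≤ 2 * 10 ^ 9 * (2 * B₁' + 1) * (L : ℝ) ^ 2 := by positivity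
  have hTpos : 0 < T := by rw [hT_def]; positivity
  refine ⟨min eJ T⁻¹, 20 * (1000 * (2 * B₁' + 1) + 600 * (L : ℝ) * (6 * (2 * B₁' + 1) + 18)), C₁, C₂, ζ, δ₁,
    lt_min heJ (inv_pos.mpr hTpos), by positivity, hC₁, hC₂, hζ, hδ₁, ?_⟩
  intro F hF n K hnK e V W X he heε hWreg hEL h19 h20 h21
  have heJ' : e ≤ eJ := heε.trans (min_le_left _ _)
  have hTe : T * e ≤ 1 := by
    have h1 := heε.trans (min_le_right _ _)
    calc T * e ≤ T * T⁻¹ := mul_le_mul_of_nonneg_left h1 hTpos.le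
      _ = 1 := mul_inv_cancel₀ hTpos.ne'
  have w1 : 10 ^ 7 * (L : ℝ) ^ 3 * e ≤ 1 := summand_window (by rw [hT_def]; linarith) he.le hTe
  have w2 : 10 ^ 9 * (L : ℝ) ^ 2 * e ≤ 1 := summand_window (by rw [hT_def]; linarith) he.le hTe
  have w3 : 2 * 10 ^ 9 * (2 * B₁' + 1) * (L : ℝ) ^ 2 * e ≤ 1 := summand_window (by rw [hT_def]; linarith) he.le hTe
  subst hF
  refine ⟨?_, HJ F rfl n K hnK e V W X he heJ' hWreg hEL h19 h20 h21⟩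
  -- the SUP row by §1
  have hPL : (((F.P K).L : ℕ) : ℝ) = (F.L : ℝ) := rfl
  have hε₂pos : 0 < (2 * B₁' + 1) * e := by positivity
  have h2ε₂pos : 0 < 2 * ((2 * B₁' + 1) * e) := by positivity
  have h2B : 2 * B₁' * e ≤ (2 * B₁' + 1) * e := by rw [add_mul, one_mul]; exact le_add_of_nonneg_right he.le
  have h19' : In19 F n K ((2 * B₁' + 1) * e) W (expHermField X) X := in19_mono h2B h19
  have hαw : e * (((F.P K).L : ℕ) : ℝ) ^ 2 ≤ 1 / 10 ^ 9 := by
    rw [hPL, le_div_iff₀ (by positivity)]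
    calc e * (F.L : ℝ) ^ 2 * 10 ^ 9 = 10 ^ 9 * (F.L : ℝ) ^ 2 * e := by ring
      _ ≤ 1 := w2
  have hεw : 2 * ((2 * B₁' + 1) * e) * (((F.P K).L : ℕ) : ℝ) ^ 2 ≤ 1 / 10 ^ 9 := by
    rw [hPL, le_div_iff₀ (by positivity)]
    calc 2 * ((2 * B₁' + 1) * e) * (F.L : ℝ) ^ 2 * 10 ^ 9 = 2 * 10 ^ 9 * (2 * B₁' + 1) * (F.L : ℝ) ^ 2 * e := by ring
      _ ≤ 1 := w3
  obtain ⟨hα3, hα4', -, hε20, hsmall, hc₃, hsm, -, -⟩ := windowsS_of_small F K he h2ε₂pos hαw hεw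
  have he6 : 10 ^ 6 * (F.L : ℝ) ^ 2 * (2 * ((2 * B₁' + 1) * e)) ≤ 1 := by
    have h0 : 0 ≤ (2 * B₁' + 1) * (F.L : ℝ) ^ 2 * e := by positivity
    calc 10 ^ 6 * (F.L : ℝ) ^ 2 * (2 * ((2 * B₁' + 1) * e)) = 2 * 10 ^ 6 * ((2 * B₁' + 1) * (F.L : ℝ) ^ 2 * e) := by ring
      _ ≤ 2 * 10 ^ 9 * ((2 * B₁' + 1) * (F.L : ℝ) ^ 2 * e) := mul_le_mul_of_nonneg_right (by norm_num) h0
      _ = 2 * 10 ^ 9 * (2 * B₁' + 1) * (F.L : ℝ) ^ 2 * e := by ring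
      _ ≤ 1 := w3
  obtain ⟨hWfib, hreg⟩ := (mem_regFibrePr_iff F).mp hWreg
  intro ĉ
  have hs := norm_CmapTw_apply_le_of_in19 F hnK.le he hε₂pos w1 he6 hα3 hα4' hsmall hc₃ hsm W hreg h19' ĉ
  have heq : 20 * (1000 * ((2 * B₁' + 1) * e) + 600 * (F.L : ℝ) * (6 * ((2 * B₁' + 1) * e) + 18 * e))
      = 20 * (1000 * (2 * B₁' + 1) + 600 * (F.L : ℝ) * (6 * (2 * B₁' + 1) + 18)) * e := by ring
  rw [heq] at hs
  exact hs


end Summit.QuantumFields.YangMills.Theorems.FluctuationComparisonRegPrIntLS2BetaSigmaGrowthRate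

end
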